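import Summits.QuantumFields.YangMills.Theorems.QuantileBitRingTraceDefs
import Summits.QuantumFields.YangMills.Theorems.SlowBitWindowInsertionTracePeeling
import HarnessLib

/-!
# Two-insertion zero-flux ring traces of arbitrary period: peeling the cycle to the two-arc and one-bond-insertion forms

Support module for the door `QuantileBitPurity.QuantileBitDoor` (item stmt-QuantumFields-23925, LINE g12-B of seat ym-idea-4; target
leaf `ThermalTraceWindow.SubFemtoTraceRatio`).  The line's object is the two-insertion ring trace `TT.ringInsTrace L β n O m` (p682813:
the closed chain of `n+1` transfer kernels, the seam carrying the physical average, with an observable `O` inserted at slices `0` and `m`);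
`n = 2L-1` is definitionally the tree's `insTrace`.  This module is the ring-length-general copy of `SlowBitWindowInsertionTracePeeling`
(whose §1 `insTrace_integrand_eq` is already stated for general `n`):

* §1 `ringInsTrace_eq_twoArc_K` — for `1 ≤ m ≤ n`, Literature `integral_cyclic_het_eq_foldr` (peeling the cycle at slice `0`) gives the TWO-ARC FORM
  `ringInsTrace L β n O m = ∫ O(x) (κ^[m] (O · κ^[n-m] K_β^P(·,x)))(x) dx`, `κ` the pointwise operator of `K_β`;
* §2 `ringInsTrace_eq_twoArc` — on physical seeds every `κ` may be replaced by the pointwise operator `κ_P` of `K_β^P`;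
* §3 `ringInsTrace_eq_insertOne` — the ONE-BOND-INSERTION FORM `ringInsTrace L β n O m = ∫∫ X_m(x,y) (κ_P^[n-m] K_β^P(·,x))(y) dy dx` with the
  composite bond `X_m(x,y) = O(x) K_β^{P,(m)}(x,y) O(y)` — the left-hand side of Literature `hasSum_integral_iterate_insert_one` (spectral side:
  companion module `QuantileBitRingTraceSpectral`).

HONEST FRAMING: fixed-lattice transfer-matrix bookkeeping (Fubini and re-indexing) for an M-sized support item of a DRAFT line onto a RECORD rung
(K2); no renormalisation-group content; nothing here bears on infinite volume, the continuum limit, a mass gap or Clay.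
References: [cite: MontvayMunster1994, (3.145)]; [cite: Luscher1983, §2]; [cite: ReedSimonI1980, Thm. VI.23].
-/

set_option autoImplicit false

noncomputable section

open MeasureTheory Filter Topology Real Function
open Literature.MathematicalPhysics.QuantumFieldTheory
open Literature.MathematicalPhysics.QuantumLattice
open Literature.Analysis.OperatorTheory.YMMatrixModel
open Literature.Analysis.OperatorTheory
open scoped InnerProductSpace BigOperators

namespace Summit.QuantumFields.YangMills.Theorems.FemtoTransferGap.TT

open Summit.QuantumFields.YangMills.Theorems.FemtoTransferGap
open Summit.QuantumFields.YangMills.Theorems.FemtoTransferGap.PhysL2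

variable {L : ℕ} [NeZero L]

/-! ## §1 Peeling: the two-arc form with `K_β`-iterates -/

/-- **Two-arc form of the two-insertion ring trace, `K_β`-iterates.**  For `1 ≤ m ≤ n` and a bounded measurable `O`,
`ringInsTrace L β n O m = ∫ O(x) · (κ^[m] (y ↦ O(y) · (κ^[n-m] K_β^P(·, x))(y)))(x) dx`, `κ f = ∫ K_β(·,z) f(z) dz`: the cycle of `n+1` bonds is
cut at slice `0` (Literature `integral_cyclic_het_eq_foldr`), the arc `0 → m` of `m` bonds and the arc `m → 0` of `n + 1 - m` bonds (the last of
them the physically averaged bond) become kernel iterates. [cite: MontvayMunster1994, (3.145)] -/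
theorem ringInsTrace_eq_twoArc_K (β : ℝ) {O : GaugeConfig 3 L SU2 → ℝ} (hOm : Measurable O) {CO : ℝ} (hOb : ∀ U, |O U| ≤ CO)
    {n m : ℕ} (hm : 1 ≤ m) (hmn : m ≤ n) :
    ringInsTrace L β n O m = ∫ x, O x * ((fun f : GaugeConfig 3 L SU2 → ℝ => fun w => ∫ z, transferKernel su2Rep β w z * f z ∂configMeasure SU2 L)^[m]
      (fun y => O y * ((fun f : GaugeConfig 3 L SU2 → ℝ => fun w => ∫ z, transferKernel su2Rep β w z * f z ∂configMeasure SU2 L)^[n - m]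
        (fun w => physKernel β w x)) y)) x ∂configMeasure SU2 L := by
  obtain ⟨M, hM0, hM⟩ := exists_abs_transferKernel_le (L := L) β
  have hCO : 0 ≤ CO := (abs_nonneg _).trans (hOb (fun _ => 1))
  set K := transferKernel (L := L) su2Rep β with hKdef
  set κ : ℕ → GaugeConfig 3 L SU2 → GaugeConfig 3 L SU2 → ℝ := fun s => if s = n then (fun x y => physKernel (L := L) β x y * O y)
        else if s + 1 = m then (fun x y => K x y * O y) else K with hκdef
  -- measurability and a uniform bound of the bond kernels
  have hKm : Measurable (uncurry K) := (stronglyMeasurable_transferKernel (L := L) β).measurable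
  have hKPm : Measurable (uncurry (physKernel (L := L) β)) := (stronglyMeasurable_physKernel (L := L) β).measurable
  have hOm2 : Measurable fun p : GaugeConfig 3 L SU2 × GaugeConfig 3 L SU2 => O p.2 := hOm.comp measurable_snd
  have hκ : ∀ t, Measurable (uncurry (κ t)) := fun t => by
    by_cases ht : t = n
    · simp only [hκdef, ht, if_true]; exact hKPm.mul hOm2
    · by_cases ht' : t + 1 = m
      · simp only [hκdef, ht, if_false, ht', if_true]; exact hKm.mul hOm2
      · simp only [hκdef, ht, if_false, ht']; exact hKm
  have hC : ∀ t x y, ‖κ t x y‖ ≤ M * max CO 1 := fun t x y => by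
    have h1 : ‖K x y‖ ≤ M := by rw [Real.norm_eq_abs]; exact hM x y
    have h2 : ‖physKernel β x y‖ ≤ M := by rw [Real.norm_eq_abs]; exact abs_physKernel_le hM x y
    have h3 : ‖O y‖ ≤ max CO 1 := by rw [Real.norm_eq_abs]; exact (hOb y).trans (le_max_left _ _)
    have h4 : M ≤ M * max CO 1 := le_mul_of_one_le_right hM0 (le_max_right _ _)
    by_cases ht : t = n
    · simp only [hκdef, ht, if_true]; rw [norm_mul]; exact mul_le_mul h2 h3 (norm_nonneg _) hM0
    · by_cases ht' : t + 1 = m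
      · simp only [hκdef, ht, if_false, ht', if_true]; rw [norm_mul]; exact mul_le_mul h1 h3 (norm_nonneg _) hM0
      · simp only [hκdef, ht, if_false, ht']; exact h1.trans h4
  -- Step 1: the cyclic integral, relabelled to `Fin (1 + (n-1) + 1)`, then peeled
  have hn1 : n + 1 = 1 + (n - 1) + 1 := by omega
  have h1 : ringInsTrace L β n O m =
      ∫ V : Fin (n + 1) → GaugeConfig 3 L SU2, ∏ t : Fin (n + 1), κ t (V t) (V (t + 1)) ∂(Measure.pi fun _ => configMeasure SU2 L) := by
    unfold ringInsTrace
    refine integral_congr_ae (ae_of_all _ fun V => ?_)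
    exact insTrace_integrand_eq β O hm hmn V
  have h2 := integral_cyclic_congr_fin (L := L) hn1 κ (configMeasure SU2 L)
  have h3 := integral_cyclic_het_eq_foldr (ρ := configMeasure SU2 L) hκ hC (n - 1)
  rw [h1, h2, h3]
  refine integral_congr_ae (ae_of_all _ fun x => ?_)
  dsimp only
  -- Step 2: split the nested operators: `m - 1` bonds `K`, the bond `K · O`, then `n - m` bonds `K`
  have hsplit : n - 1 + 1 = (m - 1) + (1 + (n - m)) := by omega
  have hseed : (fun w => κ (n - 1 + 1) w x) = fun w => physKernel β w x * O x := by
    funext w; simp [hκdef, show n - 1 + 1 = n by omega]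
  rw [hseed]
  have hG := foldr_add_eq_foldr_foldr (fun (i : ℕ) (f : GaugeConfig 3 L SU2 → ℝ) => fun w => ∫ y, κ i w y * f y ∂configMeasure SU2 L)
    (m - 1) (1 + (n - m)) (fun w => physKernel β w x * O x)
  rw [show (m - 1) + (1 + (n - m)) = n - 1 + 1 by omega] at hG
  rw [hG]
  have hG2 := foldr_add_eq_foldr_foldr (fun (i : ℕ) (f : GaugeConfig 3 L SU2 → ℝ) => fun w => ∫ y, κ (i + (m - 1)) w y * f y ∂configMeasure SU2 L)
    1 (n - m) (fun w => physKernel β w x * O x)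
  rw [hG2, Fin.foldr_succ, Fin.foldr_zero]
  simp only [Fin.val_zero, Nat.zero_add]
  -- the last block: `n - m` bonds `K`
  have hlastblock := foldr_op_eq_iterate_of_eq (ρ := configMeasure SU2 L) κ K (n - m) (1 + (m - 1))
    (fun i hi => by
      have hi1 : i + (1 + (m - 1)) ≠ n := by omega
      have hi2 : i + (1 + (m - 1)) + 1 ≠ m := by omega
      simp [hκdef, hi1, hi2]) (fun w => physKernel β w x * O x)
  have hidx : (fun (i : Fin (n - m)) (f : GaugeConfig 3 L SU2 → ℝ) => fun w => ∫ y, κ ((i : ℕ) + 1 + (m - 1)) w y * f y ∂configMeasure SU2 L) =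
      fun (i : Fin (n - m)) (f : GaugeConfig 3 L SU2 → ℝ) => fun w => ∫ y, κ ((i : ℕ) + (1 + (m - 1))) w y * f y ∂configMeasure SU2 L := by
    funext i f w; simp only [Nat.add_assoc]
  rw [hidx, hlastblock, iterate_kernelOp_mul_const]
  -- the middle bond: `κ_{m-1} = K · O`
  have hmid : κ (m - 1) = fun x y => K x y * O y := by
    have h1 : m - 1 ≠ n := by omega
    have h2 : m - 1 + 1 = m := by omega
    simp [hκdef, h1, h2]
  rw [hmid]
  dsimp only
  -- the first block: `m - 1` bonds `K`
  have hfirst := foldr_op_eq_iterate_of_eq (ρ := configMeasure SU2 L) κ K (m - 1) 0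
    (fun i hi => by
      have hi1 : i ≠ n := by omega
      have hi2 : i + 1 ≠ m := by omega
      simp [hκdef, hi1, hi2])
  have hidx0 : (fun (i : Fin (m - 1)) (f : GaugeConfig 3 L SU2 → ℝ) => fun w => ∫ y, κ (i : ℕ) w y * f y ∂configMeasure SU2 L) =
      fun (i : Fin (m - 1)) (f : GaugeConfig 3 L SU2 → ℝ) => fun w => ∫ y, κ ((i : ℕ) + 0) w y * f y ∂configMeasure SU2 L := by
    funext i f w; simp only [Nat.add_zero]
  rw [hidx0, hfirst]
  -- pull the scalar `O x` out of the whole chain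
  have hin : (fun w => ∫ y, K w y * O y * (((fun f : GaugeConfig 3 L SU2 → ℝ => fun w => ∫ z, K w z * f z ∂configMeasure SU2 L)^[n - m]
        (fun w => physKernel β w x)) y * O x) ∂configMeasure SU2 L) =
      fun w => ((fun f : GaugeConfig 3 L SU2 → ℝ => fun w => ∫ z, K w z * f z ∂configMeasure SU2 L)
        (fun y => O y * ((fun f : GaugeConfig 3 L SU2 → ℝ => fun w => ∫ z, K w z * f z ∂configMeasure SU2 L)^[n - m]
          (fun w => physKernel β w x)) y)) w * O x := by
    funext w
    dsimp only
    rw [← integral_mul_const]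
    exact integral_congr_ae (ae_of_all _ fun y => by ring)
  rw [hin, iterate_kernelOp_mul_const]
  dsimp only
  have hm1 : (m - 1).succ = m := by omega
  rw [mul_comm, ← Function.iterate_succ_apply, hm1]

/-! ## §2 The two-arc form with `K_β^P`-iterates -/

/-- **Two-arc form of the two-insertion ring trace, `K_β^P`-iterates.**  For a PHYSICAL `O` and `1 ≤ m ≤ n`,
`ringInsTrace L β n O m = ∫ O(x) · (κ_P^[m] (y ↦ O(y) · (κ_P^[n-m] K_β^P(·, x))(y)))(x) dx` with `κ_P f = ∫ K_β^P(·,z) f(z) dz`: on the physical seed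
`K_β^P(·,x)` and on `O · (physical)` the `K_β`- and `K_β^P`-iterates coincide (`iterate_physKernelOp_eq`) — the path-space form of
`Tr(M_O (PK_βP)^m M_O (PK_βP)^{n+1-m})`. [cite: Luscher1983, §2] [cite: MontvayMunster1994, (3.145)] -/
theorem ringInsTrace_eq_twoArc (β : ℝ) {O : GaugeConfig 3 L SU2 → ℝ} (hO : IsPhys O) {n m : ℕ} (hm : 1 ≤ m) (hmn : m ≤ n) :
    ringInsTrace L β n O m = ∫ x, O x * ((fun f : GaugeConfig 3 L SU2 → ℝ => fun w => ∫ z, physKernel β w z * f z ∂configMeasure SU2 L)^[m]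
      (fun y => O y * ((fun f : GaugeConfig 3 L SU2 → ℝ => fun w => ∫ z, physKernel β w z * f z ∂configMeasure SU2 L)^[n - m]
        (fun w => physKernel β w x)) y)) x ∂configMeasure SU2 L := by
  obtain ⟨M, -, hM⟩ := exists_abs_transferKernel_le (L := L) β
  obtain ⟨CO, hOb⟩ := hO.bounded
  rw [ringInsTrace_eq_twoArc_K β hO.measurable hOb hm hmn]
  refine integral_congr_ae (ae_of_all _ fun x => ?_)
  dsimp only
  obtain ⟨h1, h2⟩ := iterate_physKernelOp_eq hM (isPhys_physKernel_left hM x) (n - m)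
  rw [h1]
  have hh : IsPhys fun y => O y * ((fun f : GaugeConfig 3 L SU2 → ℝ => fun w => ∫ z, transferKernel su2Rep β w z * f z ∂configMeasure SU2 L)^[n - m]
      (fun w => physKernel β w x)) y :=
    IsPhys.mul_of_invariant h2 hO.measurable hOb hO.gaugeInv hO.zeroFlux
  rw [(iterate_physKernelOp_eq hM hh m).1]

/-! ## §3 The one-bond-insertion form -/

/-- **One-bond-insertion form of the two-insertion ring trace.**  For a physical `O` and `1 ≤ m ≤ n`,
`ringInsTrace L β n O m = ∫∫ X_m(x,y) (κ_P^[n-m] K_β^P(·,x))(y) dy dx` with the composite bond `X_m(x,y) = O(x) K_β^{P,(m)}(x,y) O(y)`,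
`K_β^{P,(m)}(x,y) = (κ_P^[m-1] K_β^P(·,y))(x)` — the left-hand side of Literature `hasSum_integral_iterate_insert_one`
(`Tr(𝕏_m (PK_βP)^{n+1-m})`). [cite: ReedSimonI1980, Thm. VI.23] [cite: MontvayMunster1994, (3.145)] -/
theorem ringInsTrace_eq_insertOne (β : ℝ) {O : GaugeConfig 3 L SU2 → ℝ} (hO : IsPhys O) {n m : ℕ} (hm : 1 ≤ m) (hmn : m ≤ n) :
    ringInsTrace L β n O m = ∫ x, ∫ y,
      (O x * ((fun f : GaugeConfig 3 L SU2 → ℝ => fun w => ∫ z, physKernel β w z * f z ∂configMeasure SU2 L)^[m - 1]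
        (fun w => physKernel β w y)) x * O y) *
      ((fun f : GaugeConfig 3 L SU2 → ℝ => fun w => ∫ z, physKernel β w z * f z ∂configMeasure SU2 L)^[n - m]
        (fun z => physKernel β z x)) y ∂configMeasure SU2 L ∂configMeasure SU2 L := by
  obtain ⟨M, -, hM⟩ := exists_abs_transferKernel_le (L := L) β
  obtain ⟨CO, hOb⟩ := hO.bounded
  have hKP := stronglyMeasurable_physKernel (L := L) β
  have hCP : ∀ U V : GaugeConfig 3 L SU2, ‖physKernel β U V‖ ≤ M := fun U V => by
    rw [Real.norm_eq_abs]; exact abs_physKernel_le hM U V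
  rw [ringInsTrace_eq_twoArc β hO hm hmn]
  refine integral_congr_ae (ae_of_all _ fun x => ?_)
  dsimp only
  -- the inner observable `h_x = O · κ_P^[n-m] K_β^P(·,x)` is bounded and measurable
  have hkx : Measurable fun w : GaugeConfig 3 L SU2 => physKernel β w x := (isPhys_physKernel_left hM x).measurable
  obtain ⟨⟨B, hB⟩, hmeas⟩ := exists_bound_and_measurable_kernelIterate (μ := configMeasure SU2 L) hKP hCP hkx ⟨M, fun w => hCP w x⟩
    (n - m)
  have hhm : Measurable fun y => O y * ((fun f : GaugeConfig 3 L SU2 → ℝ => fun w => ∫ z, physKernel β w z * f z ∂configMeasure SU2 L)^[n - m]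
      (fun w => physKernel β w x)) y := hO.measurable.mul hmeas.measurable
  have hhb : ∀ y, ‖O y * ((fun f : GaugeConfig 3 L SU2 → ℝ => fun w => ∫ z, physKernel β w z * f z ∂configMeasure SU2 L)^[n - m]
      (fun w => physKernel β w x)) y‖ ≤ CO * B := fun y => by
    rw [norm_mul, Real.norm_eq_abs]
    exact mul_le_mul (hOb y) (hB y) (norm_nonneg _) ((abs_nonneg _).trans (hOb y))
  have key := integral_iterKernelP_mul (L := L) β hhm hhb (m - 1) x
  rw [show m - 1 + 1 = m by omega] at key
  rw [← key, ← integral_const_mul]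
  exact integral_congr_ae (ae_of_all _ fun y => by ring)

end Summit.QuantumFields.YangMills.Theorems.FemtoTransferGap.TT

end
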